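import Literature.Computability.MetaComplexity.PolynomialCalculusRespectfulExpanderDegree
import HarnessLib

/-!
# Mikša–Nordström's Theorem 3.6 (generalised Alekhnovich–Razborov method): the induction and the theorem

Continuation of `PolynomialCalculusRespectfulExpanderDegree.lean` (operator `R = MiksaNordstrom.L`,
Lemmas 3.9–3.11, `R(axiom) = 0`, `R(1) = 1`).  Here: the third property `R(x t) = R(x · R(t))`
(`Lmon_add_single`, MN15's chain of equalities in the proof of Thm 3.6 together with Lemma 3.13 =
arXiv Lemma 31, whose support inclusion we obtain from Lemma 3.10 and the idempotence of the
closure), the induction over a degree-`≤ D` derivation in Krajíček's `PC.DerivableInDegree`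
(`L_eq_zero_of_derivable`; product rule monomial by monomial, variable by variable) and
**`MiksaNordstrom.not_refutableInDegree`** = MN15 Thm 3.6 (arXiv Thm 11): an `(s, δ, ξ, E)`-respectful
boundary expander (`δ > 0`, `s ≥ 2`, every `𝒱 k` respecting `E`) of overlap `≤ ℓ` (`ℓ ≥ 1`) whose
subfamilies of size `≤ s` are satisfiable together with `E` admits no PC refutation of degree `≤ D`,
`D ≤ (δs - 2ξ)/(2ℓ)`, of any CNF made of clauses of `E` and of the `𝓕 i` — over any field.

Source: M. Mikša, J. Nordström, CCC 2015 (LIPIcs 33) §3 = arXiv:1505.01358 §3.5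
[MiksaNordstrom2015] (held copy `paper:arxiv-1505.01358`).
-/

noncomputable section

namespace Literature.Computability.MetaComplexity

namespace MiksaNordstrom

open Finset MvPolynomial Literature.Computability.Complexity PCResidue

/-- Colex on finite sets of naturals is well founded. [folklore] -/
private theorem wf_colex_nat' : WellFoundedLT (Colex (Finset ℕ)) :=
  Finset.orderIsoColex.symm.toOrderEmbedding.wellFoundedLT

-- `Prop`-valued, absent from Mathlib for this type, proof-irrelevant: cannot override anything.
attribute [local instance] wf_colex_nat'

variable {ι κ : Type*} [Fintype ι] [DecidableEq ι] [Fintype κ] [DecidableEq κ]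
variable {𝓕 : ι → CNF ℕ} {𝒱 : κ → Finset ℕ} {E : CNF ℕ} {s : ℝ} {K : Type*} [Field K]

/-- Adding the variable `x_j` to a monomial adds `j` to its variables. [folklore] -/
private theorem support_add_single' (t : ℕ →₀ ℕ) (j : ℕ) :
    (t + Finsupp.single j 1).support = insert j t.support := by
  classical
  ext i
  simp only [Finsupp.mem_support_iff, Finsupp.add_apply, Finsupp.single_apply, Finset.mem_insert]
  by_cases h : j = i
  · subst h; simp
  · simp [h, Ne.symm h]

omit [Fintype ι] [DecidableEq ι] [DecidableEq κ] in
/-- `N` of the (single) monomial of `monomial t a`. [folklore] -/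
private theorem nbhd_subset_of_mem_support_monomial' {t t' : ℕ →₀ ℕ} {a : K}
    (ht : t' ∈ (monomial t a).support) : nbhd 𝒱 t' ⊆ nbhd 𝒱 t := by
  classical
  rw [Finset.mem_singleton.1 (support_monomial_subset ht)]

/-- The variables of a clause polynomial are variables of its literals. [Krajíček 2019, (6.0.1)]
[folklore] -/
private theorem exists_of_mem_vars_ofClause {C : Clause ℕ} {j : ℕ}
    (hj : j ∈ (PC.ofClause K C).vars) : ∃ l ∈ C, l.1 = j := by
  classical
  induction C with
  | nil => simp [PC.ofClause_nil] at hj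
  | cons l C ih =>
    rw [PC.ofClause_cons] at hj
    rcases Finset.mem_union.1 (vars_mul _ _ hj) with h | h
    · refine ⟨l, by simp, ?_⟩
      unfold PC.ofLiteral at h
      split_ifs at h
      · have := vars_sub_subset (p := (1 : MvPolynomial ℕ K)) (q := X l.1) h
        rw [vars_one, Finset.empty_union, vars_X, Finset.mem_singleton] at this
        exact this.symm
      · rw [vars_X, Finset.mem_singleton] at h; exact h.symm
    · obtain ⟨l', hl', h'⟩ := ih h
      exact ⟨l', by simp [hl'], h'⟩

omit [Fintype ι] [DecidableEq ι] in
/-- Lemma 3.10 as an inclusion: `N(R_{⟨I ∧ E⟩}(p)) ⊆ N(p) ∪ N(I)` (with `N(p) ⊆ U`).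
[Mikša–Nordström 2015, Lemma 3.10] [cite: MiksaNordstrom2015, Lemma 3.10] -/
theorem nbhd_residue_subset {U : Finset κ} {I : Finset ι} {p : MvPolynomial ℕ K}
    (hp : ∀ t ∈ p.support, nbhd 𝒱 t ⊆ U) (hres : ∀ k, ∃ a, Respects (𝒱 k) a E) {t : ℕ →₀ ℕ}
    (ht : t ∈ (residue (locSol 𝓕 E I) p).support) : nbhd 𝒱 t ⊆ U ∪ nbrs 𝓕 𝒱 I := by
  intro k hk
  by_contra h
  rw [Finset.mem_union, not_or] at h
  exact notMem_nbhd_of_mem_support_residue hp h.1 h.2 (hres k) ht hk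

/-- **`R(x t) = R(x · R(t))`** for a monomial `t` and a variable `x = x_j` with
`|N(x t)| ≤ δs/2 - ξ`. [Mikša–Nordström 2015, proof of Thm 3.6 (the chain of equalities) with
Lemma 3.13 (arXiv Lemma 31)] [cite: MiksaNordstrom2015, Theorem 3.6] -/
theorem Lmon_add_single {δ ξ : ℝ} (hexp : IsRespExpander 𝓕 𝒱 E s δ ξ) (hδ : 0 < δ) (hs : 0 ≤ s)
    (hres : ∀ k, ∃ a, Respects (𝒱 k) a E) (t : ℕ →₀ ℕ) (j : ℕ)
    (hsz : ((nbhd 𝒱 (t + Finsupp.single j 1)).card : ℝ) ≤ δ * s / 2 - ξ) :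
    Lmon 𝓕 𝒱 E s K (t + Finsupp.single j 1) = L 𝓕 𝒱 E s K (X j * Lmon 𝓕 𝒱 E s K t) := by
  classical
  set t' := t + Finsupp.single j 1 with ht'
  set U := nbhd 𝒱 t with hU
  set U' := nbhd 𝒱 t' with hU'
  set S := msupp 𝓕 𝒱 E s U with hS
  set S' := msupp 𝓕 𝒱 E s U' with hS'
  have hUU' : U ⊆ U' := nbhd_mono (by rw [ht', support_add_single']; exact Finset.subset_insert _ _)
  have hSS' : S ⊆ S' := msupp_mono hUU'
  have hS'r : 2 * (S'.card : ℝ) ≤ s := two_mul_card_msupp_le hexp hδ hs hsz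
  have hB : ∀ W : Finset ι, 2 * ((S' \ W).card : ℝ) ≤ s := fun W =>
    le_trans (by exact_mod_cast Nat.mul_le_mul_left 2 (Finset.card_le_card Finset.sdiff_subset)) hS'r
  rw [Lmon]
  change residue (locSol 𝓕 E S') (monomial t' 1) = _
  set R := Lmon 𝓕 𝒱 E s K t with hR
  have hRsupp : ∀ u ∈ R.support, nbhd 𝒱 u ⊆ U ∪ nbrs 𝓕 𝒱 S := fun u hu =>
    nbhd_residue_subset (fun u' hu' => nbhd_subset_of_mem_support_monomial' hu') hres hu
  have hXR : X j * R = ∑ u ∈ R.support, monomial (u + Finsupp.single j 1) (coeff u R) := by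
    conv_lhs => rw [R.as_sum, Finset.mul_sum]
    refine Finset.sum_congr rfl fun u _ => ?_
    rw [X, monomial_mul, one_mul, add_comm]
  have h18 : ∀ u ∈ R.support, Lmon 𝓕 𝒱 E s K (u + Finsupp.single j 1) =
      residue (locSol 𝓕 E S') (monomial (u + Finsupp.single j 1) 1) := by
    intro u hu
    have hV : nbhd 𝒱 (u + Finsupp.single j 1) ⊆ U' ∪ nbrs 𝓕 𝒱 S' := by
      intro k hk
      obtain ⟨i, hi, hik⟩ := mem_nbhd.1 hk
      rw [support_add_single', Finset.mem_insert] at hi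
      rcases hi with rfl | hi
      · exact Finset.mem_union_left _ (mem_nbhd.2 ⟨i, by
          rw [ht', support_add_single']; exact Finset.mem_insert_self _ _, hik⟩)
      · rcases Finset.mem_union.1 (hRsupp u hu (mem_nbhd.2 ⟨i, hi, hik⟩)) with h | h
        · exact Finset.mem_union_left _ (hUU' h)
        · exact Finset.mem_union_right _ (nbrs_mono hSS' h)
    rw [Lmon, ← residue_locSol_eq (fun u' hu' => nbhd_subset_of_mem_support_monomial' hu')
      (msupp_subset_msupp_of_subset_union hV) (hB _)]
  rw [hXR, map_sum, Finset.sum_congr rfl fun u hu => by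
    rw [L_monomial, h18 u hu, ← residue_smul, smul_monomial, smul_eq_mul, mul_one], ← residue_sum,
    ← hXR]
  have h12 : R = residue (locSol 𝓕 E S') (monomial t 1) := by
    rw [hR, Lmon, ← residue_locSol_eq (fun u' hu' => nbhd_subset_of_mem_support_monomial' hu')
      hSS' (hB _)]
  rw [h12, residue_mul_residue, X, monomial_mul, one_mul, add_comm]

/-- The product rule, one variable at a time. [Mikša–Nordström 2015, proof of Thm 3.6 / arXiv
Lemma 16] [cite: MiksaNordstrom2015, Theorem 3.6] -/
theorem L_mul_X_eq_zero {δ ξ : ℝ} (hexp : IsRespExpander 𝓕 𝒱 E s δ ξ) (hδ : 0 < δ) (hs : 0 ≤ s)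
    (hres : ∀ k, ∃ a, Respects (𝒱 k) a E) {g : MvPolynomial ℕ K} (hg : L 𝓕 𝒱 E s K g = 0) {j : ℕ}
    (hsz : ∀ t ∈ g.support, ((nbhd 𝒱 (t + Finsupp.single j 1)).card : ℝ) ≤ δ * s / 2 - ξ) :
    L 𝓕 𝒱 E s K (g * X j) = 0 := by
  have h1 : g * X j = ∑ t ∈ g.support, monomial (t + Finsupp.single j 1) (coeff t g) := by
    conv_lhs => rw [g.as_sum, Finset.sum_mul]
    refine Finset.sum_congr rfl fun t _ => ?_
    rw [X, monomial_mul, mul_one]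
  have h2 : X j * L 𝓕 𝒱 E s K g = ∑ t ∈ g.support, coeff t g • (X j * Lmon 𝓕 𝒱 E s K t) := by
    rw [L_eq_sum, Finset.mul_sum]
    exact Finset.sum_congr rfl fun t _ => mul_smul_comm _ _ _
  rw [h1, map_sum, Finset.sum_congr rfl fun t ht => by
    rw [L_monomial, Lmon_add_single hexp hδ hs hres t j (hsz t ht), ← map_smul], ← map_sum, ← h2,
    hg, mul_zero, map_zero]

/-- **Theorem 3.6, the invariant**: every line of a degree-`≤ D` PC derivation from clauses of
`E` and of the `𝓕 i` is mapped to `0` by `R`. [Mikša–Nordström 2015, Thm 3.6 via the operator lemma,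
arXiv:1505.01358 Lemma 19 (p. 11, after Razborov 1998)] [cite: MiksaNordstrom2015, Theorem 3.6] -/
theorem L_eq_zero_of_derivable {δ ξ : ℝ} {ℓ : ℕ} (hexp : IsRespExpander 𝓕 𝒱 E s δ ξ) (hδ : 0 < δ)
    (hs2 : 2 ≤ s) (hres : ∀ k, ∃ a, Respects (𝒱 k) a E)
    (hover : ∀ x : ℕ, (Finset.univ.filter fun k => x ∈ 𝒱 k).card ≤ ℓ)
    {D : ℕ} (hD : (ℓ : ℝ) * D ≤ δ * s / 2 - ξ) {φ : CNF ℕ} (hφ : ∀ C ∈ φ, C ∈ E ∨ ∃ i, C ∈ 𝓕 i)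
    {f : MvPolynomial ℕ K} (hf : PC.DerivableInDegree (PC.ofCNF K φ) D f) :
    L 𝓕 𝒱 E s K f = 0 := by
  classical
  have hs : 0 ≤ s := by linarith
  induction hf with
  | hyp hmem hdeg =>
    obtain ⟨C, hC, rfl⟩ := PC.mem_ofCNF.1 hmem
    rw [PC.totalDegree_ofClause] at hdeg
    -- the variable sets touching `C`
    set U : Finset κ := Finset.univ.filter fun k => Touches (𝒱 k) C with hUdef
    have hp : ∀ t ∈ (PC.ofClause K C).support, nbhd 𝒱 t ⊆ U := by
      intro t ht k hk
      obtain ⟨j, hj, hjk⟩ := mem_nbhd.1 hk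
      obtain ⟨l, hl, rfl⟩ := exists_of_mem_vars_ofClause ((mem_vars_iff_mem_support j).2 ⟨t, ht, hj⟩)
      exact Finset.mem_filter.2 ⟨Finset.mem_univ _, l, hl, hjk⟩
    have hUcard : (U.card : ℝ) ≤ δ * s / 2 - ξ := by
      have hsub : U ⊆ (C.map Prod.fst).toFinset.biUnion fun x =>
          Finset.univ.filter fun k => x ∈ 𝒱 k := by
        intro k hk
        obtain ⟨l, hl, hlk⟩ := (Finset.mem_filter.1 hk).2
        exact Finset.mem_biUnion.2 ⟨l.1, List.mem_toFinset.2 (List.mem_map.2 ⟨l, hl, rfl⟩),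
          by simp [hlk]⟩
      have h1 : U.card ≤ ℓ * C.length := by
        refine (Finset.card_le_card hsub).trans ((Finset.card_biUnion_le_card_mul _ _ _
          fun x _ => hover x).trans ?_)
        rw [mul_comm]
        exact Nat.mul_le_mul_left ℓ ((List.toFinset_card_le _).trans (by rw [List.length_map]))
      have h2 : (U.card : ℝ) ≤ ℓ * D := by
        exact_mod_cast h1.trans (Nat.mul_le_mul_left ℓ hdeg)
      linarith
    rcases hφ C hC with hCE | ⟨i, hCi⟩
    · exact L_eq_zero_of_local hexp hδ hs hp hUcard Finset.Subset.rfl (by simp [hs])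
        fun x hx => by
          change MvPolynomial.eval (fun v => if x v then (1 : K) else 0) _ = 0
          rw [PC.eval_ofClause, if_pos (hx.1 C hCE)]
    · refine L_eq_zero_of_local hexp hδ hs hp hUcard (Finset.subset_insert i _) ?_ fun x hx => ?_
      · have h1 : ((insert i (msupp 𝓕 𝒱 E s U) \ msupp 𝓕 𝒱 E s U).card : ℝ) ≤ 1 := by
          have : insert i (msupp 𝓕 𝒱 E s U) \ msupp 𝓕 𝒱 E s U ⊆ {i} := by
            intro i' hi'
            rw [Finset.mem_sdiff, Finset.mem_insert] at hi'
            rcases hi'.1 with h | h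
            · exact Finset.mem_singleton.2 h
            · exact absurd h hi'.2
          exact_mod_cast (Finset.card_le_card this).trans (Finset.card_singleton i).le
        linarith
      · change MvPolynomial.eval (fun v => if x v then (1 : K) else 0) _ = 0
        rw [PC.eval_ofClause, if_pos (hx.2 i (Finset.mem_insert_self _ _) C hCi)]
  | booleanAxiom j hdeg =>
    rw [map_sub, X_pow_eq_monomial, show (X j : MvPolynomial ℕ K) = monomial (Finsupp.single j 1) 1
      from rfl, L_monomial, L_monomial, one_smul, one_smul, sub_eq_zero, Lmon, Lmon]
    have hV : nbhd 𝒱 (Finsupp.single j 2) = nbhd 𝒱 (Finsupp.single j 1) := by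
      have h : (Finsupp.single j 2).support = (Finsupp.single j 1).support := by
        rw [Finsupp.support_single _ two_ne_zero, Finsupp.support_single _ one_ne_zero]
      exact Finset.Subset.antisymm (nbhd_mono h.subset) (nbhd_mono h.symm.subset)
    rw [hV]
    exact residue_congr fun x _ => bval_monomial_eq_of_support_eq x
      (by rw [Finsupp.support_single _ two_ne_zero, Finsupp.support_single _ one_ne_zero]) 1
  | add _ _ ih₁ ih₂ => rw [map_add, ih₁, ih₂, add_zero]
  | @mul f h _ hdeg ih =>
    by_cases hf0 : f = 0
    · rw [hf0, zero_mul, map_zero]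
    have key : ∀ N (u : ℕ →₀ ℕ) (g : MvPolynomial ℕ K), (u.sum fun _ e => e) = N → g ≠ 0 →
        L 𝓕 𝒱 E s K g = 0 → (g * monomial u 1).totalDegree ≤ D →
        L 𝓕 𝒱 E s K (g * monomial u 1) = 0 := by
      intro N
      induction N using Nat.strong_induction_on with
      | _ N ihN =>
        intro u g hN hg0 hg hdeg'
        by_cases hu : u = 0
        · rw [hu, show (monomial (0 : ℕ →₀ ℕ) (1 : K)) = 1 from rfl, mul_one]; exact hg
        obtain ⟨i, hi⟩ : ∃ i, i ∈ u.support := by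
          by_contra hne
          push Not at hne
          exact hu (Finsupp.support_eq_empty.1 (Finset.eq_empty_of_forall_notMem hne))
        have hui : u i ≠ 0 := Finsupp.mem_support_iff.1 hi
        set u' := u - Finsupp.single i 1 with hu'
        have huu' : u = u' + Finsupp.single i 1 := (Finsupp.sub_add_single_one_cancel hui).symm
        have hdegu : (u.sum fun _ e => e) = (u'.sum fun _ e => e) + 1 := by
          conv_lhs => rw [huu']
          rw [Finsupp.sum_add_index' (fun _ => rfl) (fun _ _ _ => rfl), Finsupp.sum_single_index rfl]
        have hmon : (monomial u (1 : K) : MvPolynomial ℕ K) = monomial u' 1 * X i := by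
          rw [X, monomial_mul, mul_one, ← huu']
        have hdg : (g * monomial u' 1).totalDegree + 1 = (g * monomial u 1).totalDegree := by
          rw [totalDegree_mul_of_isDomain hg0 (monomial_eq_zero.not.2 one_ne_zero),
            totalDegree_mul_of_isDomain hg0 (monomial_eq_zero.not.2 one_ne_zero),
            totalDegree_monomial _ one_ne_zero, totalDegree_monomial _ one_ne_zero, hdegu, add_assoc]
        have ih' : L 𝓕 𝒱 E s K (g * monomial u' 1) = 0 :=
          ihN _ (by omega) u' g rfl hg0 hg (by omega)
        rw [hmon, ← mul_assoc]
        refine L_mul_X_eq_zero hexp hδ hs hres ih' fun t ht => card_nbhd_add_single_le hover hD ?_ i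
        have := le_totalDegree ht
        omega
    have hexpand : f * h = ∑ u ∈ h.support, coeff u h • (f * monomial u 1) := by
      conv_lhs => rw [h.as_sum, Finset.mul_sum]
      refine Finset.sum_congr rfl fun u _ => ?_
      rw [show monomial u (coeff u h) = coeff u h • (monomial u (1 : K) : MvPolynomial ℕ K) by
        rw [smul_monomial, smul_eq_mul, mul_one], mul_smul_comm]
    rw [hexpand, map_sum]
    refine Finset.sum_eq_zero fun u hu => ?_
    have hh0 : h ≠ 0 := fun h0 => by simp [h0] at hu
    rw [map_smul, key _ u f rfl hf0 ih ?_, smul_zero]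
    calc (f * monomial u 1).totalDegree = f.totalDegree + (u.sum fun _ e => e) := by
          rw [totalDegree_mul_of_isDomain hf0 (monomial_eq_zero.not.2 one_ne_zero),
            totalDegree_monomial _ one_ne_zero]
      _ ≤ f.totalDegree + h.totalDegree := Nat.add_le_add_left (le_totalDegree hu) _
      _ = (f * h).totalDegree := (totalDegree_mul_of_isDomain hf0 hh0).symm
      _ ≤ D := hdeg

/-- **Mikša–Nordström's Theorem 3.6 (generalised Alekhnovich–Razborov method), proved.**  Let
`(𝓕, 𝒱)_E` be an `(s, δ, ξ, E)`-respectful boundary expander (`δ > 0`, `s ≥ 2`) in which every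
`𝒱 k` respects `E`, of overlap `≤ ℓ` (`ℓ ≥ 1`), such that `⋀_{i ∈ S} 𝓕 i ∧ E` is satisfiable for
every `|S| ≤ s`.  Then a CNF all of whose clauses are clauses of `E` or of some `𝓕 i` has no PC
refutation of degree `≤ D` whenever `D ≤ (δs - 2ξ)/(2ℓ)` ("any polynomial calculus refutation …
requires degree strictly greater than `(δs - 2ξ)/(2ℓ)`"). [Mikša–Nordström 2015, Thm 3.6 (arXiv
Thm 11)] [cite: MiksaNordstrom2015, Theorem 3.6] -/
theorem not_refutableInDegree {δ ξ : ℝ} {ℓ : ℕ} (hexp : IsRespExpander 𝓕 𝒱 E s δ ξ) (hδ : 0 < δ)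
    (hs2 : 2 ≤ s) (hres : ∀ k, ∃ a, Respects (𝒱 k) a E) (hℓ : 1 ≤ ℓ)
    (hover : ∀ x : ℕ, (Finset.univ.filter fun k => x ∈ 𝒱 k).card ≤ ℓ)
    (hsat : ∀ S : Finset ι, (S.card : ℝ) ≤ s → (locSol 𝓕 E S).Nonempty)
    {φ : CNF ℕ} (hφ : ∀ C ∈ φ, C ∈ E ∨ ∃ i, C ∈ 𝓕 i)
    {D : ℕ} (hD : (D : ℝ) ≤ (δ * s - 2 * ξ) / (2 * ℓ)) :
    ¬ PC.RefutableInDegree (PC.ofCNF K φ) D := by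
  have hℓpos : (0 : ℝ) < ℓ := by exact_mod_cast hℓ
  have hD' : (ℓ : ℝ) * D ≤ δ * s / 2 - ξ := by
    rw [le_div_iff₀ (by linarith)] at hD
    linarith
  have hξ : 0 ≤ δ * s / 2 - ξ := le_trans (mul_nonneg hℓpos.le (Nat.cast_nonneg D)) hD'
  intro h
  have h1 := L_eq_zero_of_derivable (K := K) hexp hδ hs2 hres hover hD' hφ h
  rw [L_one hexp hδ (by linarith) hξ hsat] at h1
  exact one_ne_zero h1

end MiksaNordstrom

end Literature.Computability.MetaComplexity
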